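import Summits.QuantumAdvantage.QuantumAdvantage.Theorems.MobiusLadderLiouvilleOrthogonalTC0SensLtf
import Summits.QuantumAdvantage.QuantumAdvantage.Theorems.MobiusLadderLiouvilleOrthogonalTC0LtfCombination
import Literature.Computability.Complexity.FourierDegree
import Literature.Computability.Complexity.FourierTails
import HarnessLib

/-!
# Crux `MobiusLadder.LiouvilleOrthogonalTC0` (stmt-QuantumAdvantage-1393): the leaf bound for a
Boolean combination of `J` thresholds of shallow decision trees

Line `Sketch`, skeleton v12 (lead `prover-line-stmt-QuantumAdvantage-1393-c6-0`), registered stub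
`stub_thrLeafJ`. After conditioning on the values of the `O(1)` genuine majority gates and a random
restriction, the function at a good leaf is a FIXED Boolean combination `G : {0,1}^J → {0,1}` of `J`
real thresholds `thr_i(x) = [θ_i ≤ Σ_a w_{ia} [T_a(x)]]` of decision trees `T a` of depth `≤ ℓ`. Its
Fourier tail is bounded uniformly: `W^{≥ D}[sgn ∘ G ∘ (thr_i)_i] ≤ 6(J+1) D^{−1/2^ℓ} + 3/√D` (`D ≥ 1`).

Proof. `thr_i = [0 ≤ q_i]` with `q_i = Σ_a w_{ia} [T_a] − θ_i` of Fourier degree `≤ ℓ` (hypothesis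
`hDEG`, the landed `StubThrLeaf.fourierDegree_thr_le`). For `D ≤ 9` the tail is `≤ 1 ≤ 3/√D`. For
`D ≥ 10`: a block pivotal for `G ∘ (thr_i)_i` at `x` is pivotal for some `thr_i`
(`LtfCombination.sens_comp_le`), so by the block-sensitivity bound for degree-`ℓ` PTFs (hypothesis
`hBS`, the landed `ptf_sum_card_blockFlip_le`) the number of pairs (point, pivotal block) is
`≤ J · 2 D^{1−1/2^ℓ} 2ⁿ = B · 2ⁿ√D` with `B = 2J D^{1−1/2^ℓ}/√D`, and Peres' conclusion `stub_tailOfSens`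
gives `W^{≥ D} ≤ 3B/√D = 6J D^{−1/2^ℓ} ≤ 6(J+1) D^{−1/2^ℓ} + 3/√D`.

* `StubThrLeafJ.one_le_three_div_sqrt` — `1 ≤ 3/√m` for `1 ≤ m ≤ 9`;
* `StubThrLeafJ.tailWeight_comb_ptf_le` — the bound for `G ∘ ([0 ≤ q_i])_i`, `fourierDegree q_i ≤ d`;
* `stub_thrLeafJ` — the registered stub, verbatim.
-/

set_option linter.dupNamespace false -- D-0017: single-problem summit ⇒ `QuantumAdvantage.QuantumAdvantage` by design

noncomputable section

namespace Summit.QuantumAdvantage.QuantumAdvantage.Theorems.LiouvilleOrthogonalTC0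

open Finset
open Literature.Computability.Complexity
open Literature.Computability.Complexity.LowDegree (tailWeight tailWeight_le_one)
open Literature.Probability.RandomGraphs.LowDegree (sgn)

namespace StubThrLeafJ

/-- For `1 ≤ m ≤ 9`, `1 ≤ 3/√m`. -/
theorem one_le_three_div_sqrt {m : ℕ} (hm : 1 ≤ m) (hm9 : m ≤ 9) : (1 : ℝ) ≤ 3 / Real.sqrt m := by
  have hmpos : (0 : ℝ) < m := Nat.cast_pos.2 (by omega)
  have hs0 : 0 < Real.sqrt m := Real.sqrt_pos.2 hmpos
  rw [le_div_iff₀ hs0, one_mul]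
  calc Real.sqrt m ≤ Real.sqrt ((3 : ℝ) ^ 2) :=
        Real.sqrt_le_sqrt (by norm_num; exact_mod_cast hm9)
    _ = 3 := Real.sqrt_sq (by norm_num)

/-- **Uniform Fourier tail of a Boolean combination of `J` bounded-degree polynomial threshold
functions** (given the block-sensitivity bound `hBS`): for real `q i` of Fourier degree `≤ d` and any
`G : {0,1}^J → {0,1}`, `W^{≥ m}[sgn ∘ G ∘ ([0 ≤ q i ·])_i] ≤ 6(J+1) m^{−1/2^d} + 3/√m` for `m ≥ 1`,
uniformly in the number of variables: the pivotal blocks of the combination are pivotal for some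
`[0 ≤ q i]` (`LtfCombination.sens_comp_le`), then `stub_tailOfSens` with `B = 2J m^{1−1/2^d}/√m`. -/
theorem tailWeight_comb_ptf_le
    (hBS : ∀ (n m d : ℕ) (p : (Fin n → Bool) → ℝ), fourierDegree p ≤ d → ∀ π : Fin n → Fin m,
      ∑ x : Fin n → Bool, ((Finset.univ.filter fun j : Fin m =>
          decide (0 ≤ p x) ≠ decide (0 ≤ p (fun i => xor (x i) (decide (π i = j))))).card : ℝ)
        ≤ 2 * (m : ℝ) ^ ((1 : ℝ) - 1 / 2 ^ d) * (2 : ℝ) ^ n)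
    {n J d : ℕ} (q : Fin J → (Fin n → Bool) → ℝ) (hq : ∀ i, fourierDegree (q i) ≤ d)
    (G : (Fin J → Bool) → Bool) {m : ℕ} (hm : 1 ≤ m) :
    tailWeight (fun x : Fin n → Bool => sgn (G (fun i => decide (0 ≤ q i x)))) m
      ≤ 6 * ((J : ℝ) + 1) * (m : ℝ) ^ (-(1 / (2 : ℝ) ^ d)) + 3 / Real.sqrt m := by
  have hmpos : (0 : ℝ) < m := Nat.cast_pos.2 (by omega)
  have hs0 : 0 < Real.sqrt m := Real.sqrt_pos.2 hmpos
  have h3 : (0 : ℝ) ≤ 3 / Real.sqrt m := by positivity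
  have hr0 : (0 : ℝ) ≤ (m : ℝ) ^ (-(1 / (2 : ℝ) ^ d)) := Real.rpow_nonneg hmpos.le _
  have hJ0 : (0 : ℝ) ≤ J := Nat.cast_nonneg J
  by_cases hm9 : m ≤ 9
  · -- small `m`: `W^{≥m} ≤ 1 ≤ 3/√m`
    have h1 : tailWeight (fun x : Fin n → Bool => sgn (G (fun i => decide (0 ≤ q i x)))) m ≤ 1 :=
      tailWeight_le_one (fun x => by cases G (fun i => decide (0 ≤ q i x)) <;> simp) m
    have h2 := one_le_three_div_sqrt hm hm9
    have h6 : (0 : ℝ) ≤ 6 * ((J : ℝ) + 1) * (m : ℝ) ^ (-(1 / (2 : ℝ) ^ d)) := by positivity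
    linarith
  · have hm10 : 10 ≤ m := by omega
    have hs0' : Real.sqrt m ≠ 0 := hs0.ne'
    set A : ℝ := (m : ℝ) ^ ((1 : ℝ) - 1 / 2 ^ d) with hA
    -- the pivotal blocks of `G ∘ ([0 ≤ q i])_i` are pivotal for some `[0 ≤ q i]`
    have hδ : ∀ π : Fin n → Fin m, ∑ x : Fin n → Bool,
        ((univ.filter fun j : Fin m => G (fun i => decide (0 ≤ q i x)) ≠
          G (fun i => decide (0 ≤ q i (fun k => xor (x k) (decide (π k = j)))))).card : ℝ)
          ≤ 2 * J * A / Real.sqrt m * (2 ^ n * Real.sqrt m) := by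
      intro π
      refine (LtfCombination.sens_comp_le G (fun i x => decide (0 ≤ q i x)) π).trans ?_
      calc _ ≤ ∑ _i : Fin J, 2 * A * (2 : ℝ) ^ n :=
            Finset.sum_le_sum fun i _ => hBS n m d (q i) (hq i) π
        _ = 2 * J * A / Real.sqrt m * (2 ^ n * Real.sqrt m) := by
            rw [Finset.sum_const, Finset.card_univ, Fintype.card_fin, nsmul_eq_mul]
            field_simp
    have h := stub_tailOfSens hm10 (B := 2 * J * A / Real.sqrt m)
      (fun x : Fin n → Bool => G (fun i => decide (0 ≤ q i x))) hδ
    -- `3B/√m = 6J m^{1-1/2^d}/m = 6J m^{-1/2^d}`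
    have hAm : A / m = (m : ℝ) ^ (-(1 / (2 : ℝ) ^ d)) := by
      rw [hA, ← Real.rpow_sub_one hmpos.ne']
      congr 1
      ring
    have hkey : 3 * (2 * J * A / Real.sqrt m) / Real.sqrt m =
        6 * J * (m : ℝ) ^ (-(1 / (2 : ℝ) ^ d)) := by
      calc 3 * (2 * J * A / Real.sqrt m) / Real.sqrt m
          = 6 * J * (A / (Real.sqrt m * Real.sqrt m)) := by ring
        _ = 6 * J * (m : ℝ) ^ (-(1 / (2 : ℝ) ^ d)) := by rw [Real.mul_self_sqrt hmpos.le, hAm]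
    calc tailWeight (fun x : Fin n → Bool => sgn (G (fun i => decide (0 ≤ q i x)))) m
        ≤ 3 * (2 * J * A / Real.sqrt m) / Real.sqrt m := h
      _ = 6 * J * (m : ℝ) ^ (-(1 / (2 : ℝ) ^ d)) := hkey
      _ ≤ 6 * ((J : ℝ) + 1) * (m : ℝ) ^ (-(1 / (2 : ℝ) ^ d)) + 3 / Real.sqrt m := by nlinarith

end StubThrLeafJ

/-- **Registered stub `stub_thrLeafJ` (U1, wave 5, v12) — leaf bound for a Boolean combination of `J`
thresholds of shallow decision trees.** With the v10 block bound `hBS` (= `ptf_sum_card_blockFlip_le`)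
and the v11 degree fact `hDEG` (= `StubThrLeaf.fourierDegree_thr_le`): writing
`[θ_i ≤ Σ_a w_{ia} T_a] = [0 ≤ q_i]` with `q_i = Σ_a w_{ia} T_a − θ_i` of Fourier degree `≤ ℓ`, the blocks
pivotal for `G ∘ (thr_i)_i` are pivotal for some `thr_i`, so the block count is `≤ J · 2D^{1−1/2^ℓ} 2ⁿ`
and `stub_tailOfSens` (`D ≥ 10`; `1 ≤ 3/√D` below) gives
`W^{≥D} ≤ 6J D^{−1/2^ℓ} ≤ 6(J+1) D^{−1/2^ℓ} + 3/√D` (`StubThrLeafJ.tailWeight_comb_ptf_le`). -/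
theorem stub_thrLeafJ
    (hBS : ∀ (n m d : ℕ) (p : (Fin n → Bool) → ℝ), fourierDegree p ≤ d → ∀ π : Fin n → Fin m,
      ∑ x : Fin n → Bool, ((Finset.univ.filter fun j : Fin m =>
          decide (0 ≤ p x) ≠ decide (0 ≤ p (fun i => xor (x i) (decide (π i = j))))).card : ℝ)
        ≤ 2 * (m : ℝ) ^ ((1 : ℝ) - 1 / 2 ^ d) * (2 : ℝ) ^ n)
    (hDEG : ∀ (n K ℓ : ℕ) (T : Fin K → DecisionTree n), (∀ a, (T a).depth ≤ ℓ) →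
      ∀ (w : Fin K → ℝ) (θ : ℝ),
        fourierDegree (fun x : Fin n → Bool =>
          (∑ a, w a * (if (T a).eval x then (1 : ℝ) else 0)) - θ) ≤ ℓ)
    {n K J ℓ D : ℕ} (T : Fin K → DecisionTree n) (hT : ∀ a, (T a).depth ≤ ℓ)
    (G : (Fin J → Bool) → Bool) (w : Fin J → Fin K → ℝ) (θ : Fin J → ℝ) (hD : 1 ≤ D) :
    tailWeight (fun x : Fin n → Bool =>
        sgn (G (fun i => decide (θ i ≤ ∑ a, w i a * (if (T a).eval x then (1 : ℝ) else 0))))) D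
      ≤ 6 * ((J : ℝ) + 1) * (D : ℝ) ^ (-(1 / (2 : ℝ) ^ ℓ)) + 3 / Real.sqrt D := by
  -- `[θ_i ≤ s_i(x)] = [0 ≤ s_i(x) − θ_i]`
  have hfun : (fun x : Fin n → Bool =>
        sgn (G (fun i => decide (θ i ≤ ∑ a, w i a * (if (T a).eval x then (1 : ℝ) else 0))))) =
      fun x => sgn (G (fun i => decide (0 ≤
        (∑ a, w i a * (if (T a).eval x then (1 : ℝ) else 0)) - θ i))) := by
    funext x
    have hv : (fun i => decide (θ i ≤ ∑ a, w i a * (if (T a).eval x then (1 : ℝ) else 0))) =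
        fun i => decide (0 ≤ (∑ a, w i a * (if (T a).eval x then (1 : ℝ) else 0)) - θ i) :=
      funext fun i => Bool.decide_congr sub_nonneg.symm
    rw [hv]
  rw [hfun]
  exact StubThrLeafJ.tailWeight_comb_ptf_le hBS
    (fun i x => (∑ a, w i a * (if (T a).eval x then (1 : ℝ) else 0)) - θ i)
    (fun i => hDEG n K ℓ T hT (w i) (θ i)) G hD

end Summit.QuantumAdvantage.QuantumAdvantage.Theorems.LiouvilleOrthogonalTC0
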